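import Mathlib.RepresentationTheory.Homological.GroupCohomology.Functoriality
import Literature.Algebra.Homology.GroupCohomologyClassEqZero
import HarnessLib

/-!
# Inhomogeneous cochains: a small toolkit for cochain-level diagram chases in `groupCohomology`

Topic `Algebra/Homology`; namespace `Literature.Algebra.Homology.InhomogeneousCochains` (grouping namespace named after the
object).  THEOREMS ONLY (no definition, no named fact, no instance, no `sorry`): element-level forms of Mathlib's
`groupCohomology.cochainsMap` / `cocyclesMap` / `map` / `π` / `iCocycles` and of the inhomogeneous differential
`inhomogeneousCochains.d`, stated in the applied-coercion form in which they appear in goals, so that a chase with explicit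
cochains `(Fin n → G) → A` can be rewritten step by step:

* `iCocycles_cocyclesMap_res` (cochain of the image of a cocycle under a pair morphism), `exists_d_eq_of_isZero` (in a
  vanishing `Hⁿ⁺¹` every cocycle bounds; with the tree's `groupCohomology_π_eq_zero_iff`);
* `cochainsMap_res_f_apply` (`(f, φ)^* y = φ ∘ y ∘ f^*`), `d_cochainsMap_f` / `d_comp_hom_apply` (chain-map property), and
  the additivity lemmas `d_apply_sub/add/neg/zero`, `d_apply_d_apply`, `cochainsMap_f_sub/neg/zero`, `iCocycles_sub`; over `ℤ`
  also `π_zsmul`, `iCocycles_zsmul`, `d_apply_zsmul`, `cochainsMap_f_zsmul` (the `ℤ`-multiples in cohomology goals elaborate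
  to `SubNegMonoid` multiples, for which `map_zsmul` is the matching lemma).
The companions `π_surjective`, `d_iCocycles`, `cochainsMap_id_f_apply`, `iCocycles_injective` are the tree's
(`GroupCohomologySemilinear`), and `groupCohomology.π_map_apply` is Mathlib's.

Written for the finite-layer chase of Neukirch–Schmidt–Wingberg (8.3.11) in the `S`-idèle cohomology
(`NumberTheory/GaloisRepresentations/IdeleSUnitsLayerChaseTwo/Three`).

## References
* K. S. Brown, *Cohomology of Groups*, GTM 87 (1982), III §1 (cochains), III §8 (functoriality `(α, f)^*`).
  [Brown1982CohomologyGroups]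
-/

noncomputable section

open CategoryTheory groupCohomology

namespace Literature.Algebra.Homology

namespace InhomogeneousCochains

universe u

section Toolkit

variable {k G H : Type u} [CommRing k] [Group G] [Group H]

/-- The cochain map of a pair morphism `(f, φ)` on an `i`-cochain: `y ↦ (g ↦ φ (y (f ∘ g)))`.
[cite: Brown1982CohomologyGroups, III §8] -/
theorem cochainsMap_res_f_apply {A : Rep.{u} k H} {B : Rep.{u} k G} (f : G →* H) (φ : Rep.res f A ⟶ B) {i : ℕ}
    (y : (Fin i → H) → A) (g : Fin i → G) :
    (cochainsMap f φ).f i y g = φ.hom (y (f ∘ g)) := rfl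

/-- `iCocycles` is linear: differences. [cite: Brown1982CohomologyGroups, III §1] -/
theorem iCocycles_sub {A : Rep.{u} k G} (n : ℕ) (z z' : cocycles A n) :
    iCocycles A n (z - z') = iCocycles A n z - iCocycles A n z' :=
  (iCocycles A n).hom.map_sub z z'

/-- The differential is linear: differences. [cite: Brown1982CohomologyGroups, III §1] -/
theorem d_apply_sub {A : Rep.{u} k G} (n : ℕ) (y y' : (Fin n → G) → A) :
    inhomogeneousCochains.d A n (y - y') = inhomogeneousCochains.d A n y - inhomogeneousCochains.d A n y' :=
  (inhomogeneousCochains.d A n).hom.map_sub y y'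

/-- The differential is linear: sums. [cite: Brown1982CohomologyGroups, III §1] -/
theorem d_apply_add {A : Rep.{u} k G} (n : ℕ) (y y' : (Fin n → G) → A) :
    inhomogeneousCochains.d A n (y + y') = inhomogeneousCochains.d A n y + inhomogeneousCochains.d A n y' :=
  (inhomogeneousCochains.d A n).hom.map_add y y'

/-- The differential is linear: negation. [cite: Brown1982CohomologyGroups, III §1] -/
theorem d_apply_neg {A : Rep.{u} k G} (n : ℕ) (y : (Fin n → G) → A) :
    inhomogeneousCochains.d A n (-y) = -inhomogeneousCochains.d A n y :=
  (inhomogeneousCochains.d A n).hom.map_neg y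

/-- The differential kills zero. [cite: Brown1982CohomologyGroups, III §1] -/
theorem d_apply_zero {A : Rep.{u} k G} (n : ℕ) :
    inhomogeneousCochains.d A n (0 : (Fin n → G) → A) = 0 :=
  (inhomogeneousCochains.d A n).hom.map_zero

/-- `d ∘ d = 0` on cochains. [cite: Brown1982CohomologyGroups, III §1] -/
theorem d_apply_d_apply {A : Rep.{u} k G} (n : ℕ) (y : (Fin n → G) → A) :
    inhomogeneousCochains.d A (n + 1) (inhomogeneousCochains.d A n y) = 0 := by
  have h := inhomogeneousCochains.d_comp_d (A := A) (n := n)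
  exact LinearMap.congr_fun (congrArg ModuleCat.Hom.hom h) y

/-- The cochain map of a pair morphism is linear: differences. [cite: Brown1982CohomologyGroups, III §8] -/
theorem cochainsMap_f_sub {A : Rep.{u} k H} {B : Rep.{u} k G} (f : G →* H) (φ : Rep.res f A ⟶ B) {i : ℕ}
    (y y' : (Fin i → H) → A) :
    (cochainsMap f φ).f i (y - y') = (cochainsMap f φ).f i y - (cochainsMap f φ).f i y' :=
  ((cochainsMap f φ).f i).hom.map_sub y y'

/-- The cochain map of a pair morphism is linear: negation. [cite: Brown1982CohomologyGroups, III §8] -/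
theorem cochainsMap_f_neg {A : Rep.{u} k H} {B : Rep.{u} k G} (f : G →* H) (φ : Rep.res f A ⟶ B) {i : ℕ}
    (y : (Fin i → H) → A) :
    (cochainsMap f φ).f i (-y) = -(cochainsMap f φ).f i y :=
  ((cochainsMap f φ).f i).hom.map_neg y

/-- The cochain map of a pair morphism kills zero. [cite: Brown1982CohomologyGroups, III §8] -/
theorem cochainsMap_f_zero {A : Rep.{u} k H} {B : Rep.{u} k G} (f : G →* H) (φ : Rep.res f A ⟶ B) {i : ℕ} :
    (cochainsMap f φ).f i (0 : (Fin i → H) → A) = 0 :=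
  ((cochainsMap f φ).f i).hom.map_zero

/-- The cochain map of a pair morphism commutes with the inhomogeneous differential (it is a chain map).
[cite: Brown1982CohomologyGroups, III §8] -/
theorem d_cochainsMap_f {A : Rep.{u} k H} {B : Rep.{u} k G} (f : G →* H) (φ : Rep.res f A ⟶ B) {i : ℕ}
    (y : (Fin i → H) → A) :
    inhomogeneousCochains.d B i ((cochainsMap f φ).f i y) =
      (cochainsMap f φ).f (i + 1) (inhomogeneousCochains.d A i y) := by
  have h := (cochainsMap f φ).comm i (i + 1)
  rw [inhomogeneousCochains.d_def, inhomogeneousCochains.d_def] at h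
  exact LinearMap.congr_fun (congrArg ModuleCat.Hom.hom h) y

/-- The cochain underlying the image of a cocycle under a pair morphism.
[cite: Brown1982CohomologyGroups, III §8] -/
theorem iCocycles_cocyclesMap_res {A : Rep.{u} k H} {B : Rep.{u} k G} (f : G →* H) (φ : Rep.res f A ⟶ B) (n : ℕ)
    (z : cocycles A n) :
    iCocycles B n (cocyclesMap f φ n z) = (cochainsMap f φ).f n (iCocycles A n z) := by
  change (cocyclesMap f φ n ≫ iCocycles B n) z = ((iCocycles A n) ≫ (cochainsMap f φ).f n) z
  rw [cocyclesMap, HomologicalComplex.cyclesMap_i]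

/-- Pointwise form of `d_cochainsMap_f` for a plain morphism of representations: the differential commutes with
post-composition. [cite: Brown1982CohomologyGroups, III §8] -/
theorem d_comp_hom_apply {A B : Rep.{u} k G} (φ : A ⟶ B) {i : ℕ} (y : (Fin i → G) → A) (g : Fin (i + 1) → G) :
    inhomogeneousCochains.d B i (fun h => φ.hom (y h)) g = φ.hom (inhomogeneousCochains.d A i y g) := by
  have h := congrFun (d_cochainsMap_f (MonoidHom.id G) φ y) g
  exact h

/-- In a group whose cohomology `Hⁿ⁺¹` vanishes, every `(n+1)`-cocycle is a coboundary.
[cite: Brown1982CohomologyGroups, III §1] -/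
theorem exists_d_eq_of_isZero {A : Rep.{u} k G} {n : ℕ} (h : Limits.IsZero (groupCohomology A (n + 1)))
    (y : (Fin (n + 1) → G) → A) (hy : inhomogeneousCochains.d A (n + 1) y = 0) :
    ∃ a : (Fin n → G) → A, inhomogeneousCochains.d A n a = y := by
  haveI := ModuleCat.subsingleton_of_isZero h
  obtain ⟨a, ha⟩ := (groupCohomology_π_eq_zero_iff A n (cocyclesMk y hy)).1 (Subsingleton.elim _ _)
  exact ⟨a, ha.trans (iCocycles_mk y hy)⟩

end Toolkit

section ToolkitInt

variable {G H : Type} [Group G] [Group H]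

/-- `π` commutes with integer multiples. [cite: Brown1982CohomologyGroups, III §1] -/
theorem π_zsmul {A : Rep ℤ G} (n : ℕ) (m : ℤ) (z : cocycles A n) : π A n (m • z) = m • π A n z :=
  map_zsmul (π A n).hom m z

/-- `iCocycles` commutes with integer multiples. [cite: Brown1982CohomologyGroups, III §1] -/
theorem iCocycles_zsmul {A : Rep ℤ G} (n : ℕ) (m : ℤ) (z : cocycles A n) :
    iCocycles A n (m • z) = m • iCocycles A n z :=
  map_zsmul (iCocycles A n).hom m z

/-- The differential commutes with integer multiples. [cite: Brown1982CohomologyGroups, III §1] -/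
theorem d_apply_zsmul {A : Rep ℤ G} (n : ℕ) (m : ℤ) (y : (Fin n → G) → A) :
    inhomogeneousCochains.d A n (m • y) = m • inhomogeneousCochains.d A n y :=
  map_zsmul (inhomogeneousCochains.d A n).hom m y

/-- The cochain map of a pair morphism commutes with integer multiples. [cite: Brown1982CohomologyGroups, III §8] -/
theorem cochainsMap_f_zsmul {A : Rep ℤ H} {B : Rep ℤ G} (f : G →* H) (φ : Rep.res f A ⟶ B) {i : ℕ}
    (m : ℤ) (y : (Fin i → H) → A) :
    (cochainsMap f φ).f i (m • y) = m • (cochainsMap f φ).f i y :=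
  map_zsmul ((cochainsMap f φ).f i).hom m y

end ToolkitInt

end InhomogeneousCochains

end Literature.Algebra.Homology

end
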